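import Mathlib
import Literature.MathematicalPhysics.QuantumLattice.SchwartzTensor
import Literature.MathematicalPhysics.AQFT.OSAxiomsSchwinger
import Literature.MathematicalPhysics.QuantumLattice.SchwingerOSAxioms
import HarnessLib

/-!
# `ContinuumLegGivenGap` (stmt-QuantumFields-15828), line `Sketch` (reshape 10): the window from (NG)

Support file for the crux item stmt-QuantumFields-15828 (registered stub `stub_windowOfNG` of the
line `Sketch`, reshape 10: UV-discharge dock on the compactness socket stmt-15926
`FlowLineStateSpace.OSLimitFromUniformBounds`). It is the converse of the landed `stub_witness`
(`ConvexGribovBodyContinuumLegGivenGapStubWitness`).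

**Statement** (`stub_windowOfNG`, over an ABSTRACT family of `n`-point functionals
`LS : ℕ → (n : ℕ) → 𝓢((Fin n → ℝ⁴), ℂ) → ℂ`). Suppose (UVB): for some `s, α, β'`, for every `n` and
every off-diagonal `F`, eventually in `k`, `‖LS k n F‖ ≤ α (n!)^β' |F|_{n s}`; and (NG): some
off-diagonal triangle tensor `F₃ = f ⊗ g ⊗ h` has `δ ≤ ‖LS k 3 F₃‖` frequently in `k` for some
`δ > 0`. Then there is a window: `s₃ ≠ 0`, a strictly increasing `φ`, families `f j, g j, h j`,
off-diagonal tensors `F₃ j = f j ⊗ g j ⊗ h j` and weights `w j > 0` with, for every `ε > 0`,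
eventually in `j`, eventually in `k`, `‖LS (φ k) 3 (F₃ j) / w j - s₃‖ ≤ ε`.

**Proof.** Pure logic plus Bolzano–Weierstrass. From (UVB) at `n = 3` the sequence `‖LS k 3 F₃‖`
is eventually bounded by `B := α (3!)^β' |F₃|_{3 s}`, so `δ ≤ ‖LS k 3 F₃‖ ≤ B` frequently
(`Filter.Frequently.and_eventually`); extract a strictly increasing `φ₀` into that set
(`Filter.extraction_of_frequently_atTop`). The complex sequence `LS (φ₀ k) 3 F₃` lives in the
closed ball of radius `B`, so (`tendsto_subseq_of_bounded`, `ℂ` proper) along a further strictly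
increasing `ψ` it converges to some `s₃`, and `δ ≤ ‖s₃‖` by `ge_of_tendsto'`, whence `s₃ ≠ 0`.
The witnesses are `s₃`, `φ := φ₀ ∘ ψ`, and the CONSTANT families `f, g, h, F₃`, `w := 1`. [folklore]
-/

noncomputable section

namespace Summit.QuantumFields.YangMills.Theorems.ContinuumLegGivenGap

open scoped SchwartzMap
open Filter Topology
open Literature.MathematicalPhysics.QuantumLattice Literature.MathematicalPhysics.AQFT

/-- `stub_windowOfNG` — **the card's registered window is implied by (NG) under (UVB)** (reshape 10;
converse of the landed `stub_witness`): if some off-diagonal triangle tensor has `‖LS_k 3 F₃‖ ≥ δ > 0`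
frequently, and (UVB) bounds `‖LS_k 3 F₃‖` eventually, then along a strictly increasing `φ` the bounded complex
sequence `LS_{φ k} 3 F₃` converges (Bolzano–Weierstrass) to some `s₃` with `‖s₃‖ ≥ δ`, and the constant family
`F₃ j := F₃`, `w j := 1` is a window. Pure logic over an abstract functional. [folklore] -/
theorem stub_windowOfNG :
    ∀ (LS : (k n : ℕ) → SchwartzMap (Fin n → EuclideanSpace ℝ (Fin 4)) ℂ → ℂ),
      (∃ (s : ℕ) (α β' : ℝ), ∀ (n : ℕ) (F : SchwartzMap (Fin n → EuclideanSpace ℝ (Fin 4)) ℂ),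
        IsOffDiagonal F → ∀ᶠ k in atTop, ‖LS k n F‖ ≤ α * (n.factorial : ℝ) ^ β' * schwartzNorm (n * s) F) →
      (∃ (f g h : SchwartzMap (EuclideanSpace ℝ (Fin 4)) ℂ) (F₃ : SchwartzMap (Fin 3 → EuclideanSpace ℝ (Fin 4)) ℂ),
        IsTensorOf F₃ ![f, g, h] ∧ IsOffDiagonal F₃ ∧ ∃ δ : ℝ, 0 < δ ∧ ∃ᶠ k in atTop, δ ≤ ‖LS k 3 F₃‖) →
      ∃ (s₃ : ℂ) (φ : ℕ → ℕ) (f g h : ℕ → SchwartzMap (EuclideanSpace ℝ (Fin 4)) ℂ)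
        (F₃ : ℕ → SchwartzMap (Fin 3 → EuclideanSpace ℝ (Fin 4)) ℂ) (w : ℕ → ℝ),
        s₃ ≠ 0 ∧ StrictMono φ ∧ (∀ j, 0 < w j) ∧
          (∀ j, IsTensorOf (F₃ j) ![f j, g j, h j] ∧ IsOffDiagonal (F₃ j)) ∧
          ∀ ε : ℝ, 0 < ε → ∀ᶠ j in atTop, ∀ᶠ k in atTop, ‖LS (φ k) 3 (F₃ j) / (w j : ℂ) - s₃‖ ≤ ε := by
  rintro LS ⟨s, α, β', hUVB⟩ ⟨f, g, h, F₃, hT, hOD, δ, hδ, hfreq⟩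
  -- (UVB) at `n = 3`: an eventual bound `B` on `‖LS k 3 F₃‖`
  set B : ℝ := α * ((3 : ℕ).factorial : ℝ) ^ β' * schwartzNorm (3 * s) F₃ with hB
  have hev : ∀ᶠ k in atTop, ‖LS k 3 F₃‖ ≤ B := hUVB 3 F₃ hOD
  -- extraction into the frequently-set `δ ≤ ‖LS k 3 F₃‖ ≤ B`
  obtain ⟨φ₀, hφ₀, hφ₀P⟩ := extraction_of_frequently_atTop (hfreq.and_eventually hev)
  -- Bolzano–Weierstrass in `ℂ` on the closed ball of radius `B`
  have hmem : ∀ k, LS (φ₀ k) 3 F₃ ∈ Metric.closedBall (0 : ℂ) B := fun k =>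
    mem_closedBall_zero_iff.2 (hφ₀P k).2
  obtain ⟨s₃, -, ψ, hψ, hlim⟩ := tendsto_subseq_of_bounded (x := fun k => LS (φ₀ k) 3 F₃)
    Metric.isBounded_closedBall hmem
  -- the limit has norm at least `δ`, hence is non-zero
  have hnorm : Tendsto (fun k => ‖LS (φ₀ (ψ k)) 3 F₃‖) atTop (𝓝 ‖s₃‖) := hlim.norm
  have hδs₃ : δ ≤ ‖s₃‖ := ge_of_tendsto' hnorm fun k => (hφ₀P (ψ k)).1
  have hs₃ : s₃ ≠ 0 := by
    intro h0
    rw [h0, norm_zero] at hδs₃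
    exact absurd hδs₃ (not_le.mpr hδ)
  refine ⟨s₃, φ₀ ∘ ψ, fun _ => f, fun _ => g, fun _ => h, fun _ => F₃, fun _ => 1, hs₃, hφ₀.comp hψ,
    fun _ => one_pos, fun _ => ⟨hT, hOD⟩, fun ε hε => Eventually.of_forall fun _ => ?_⟩
  -- the window clause: `‖LS (φ₀ (ψ k)) 3 F₃ / 1 - s₃‖ ≤ ε` eventually in `k`
  have hsub : Tendsto (fun k => LS (φ₀ (ψ k)) 3 F₃ - s₃) atTop (𝓝 0) := by
    simpa using hlim.sub_const s₃
  have hsubn : Tendsto (fun k => ‖LS (φ₀ (ψ k)) 3 F₃ - s₃‖) atTop (𝓝 0) := by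
    simpa using hsub.norm
  filter_upwards [hsubn.eventually (Iic_mem_nhds hε)] with k hk
  simpa [Complex.ofReal_one, div_one, Function.comp_apply] using (hk : ‖LS (φ₀ (ψ k)) 3 F₃ - s₃‖ ≤ ε)

end Summit.QuantumFields.YangMills.Theorems.ContinuumLegGivenGap

end
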